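import Literature.Probability.LatticeModels.DobrushinComparisonDefect
import Literature.Probability.LatticeModels.DobrushinMetricStates
import HarnessLib

/-!
# Dobrushin's comparison theorem with defects, Vasserstein form: the measure level

`DobrushinComparisonDefect.lean` proves Föllmer's Comparison Theorem (2.8) with a defect vector in
the abstract dusting framework (`DobrushinMetric.DustingData`: an invariant state `E₁`, ANY state
`E₂` with defect `b`, a super-solution `d` of `b + C d ≤ d`). This file supplies the measure theory,
exactly as `DobrushinMetricStates.lean` does for the defect-free theory: for a specification `γ`
satisfying Dobrushin's condition in the Vasserstein form (`IsKRContraction γ r nbr C`, Föllmer 1988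
Ch. I (2.20)),
* the expectation under ANY probability measure `ν` is a state of the dusting data
  `krDustingData` (`isState_integral`);
* the printed defect `b_k = ∫ R(π_k(·|η), ν_k(·|η)) ν(dη)` ((2.2)/(2.21)) is used in the proof of
  Lemma (2.5) only through `|∫ (π_k f − f) dν| ≤ b_k δ_k(f)`; we take this FUNCTIONAL form as the
  hypothesis (`hasDefect_integral`) — it needs no conditional distributions of `ν` and is the form in
  which a defect is certified in practice (e.g. for a tilt `ν = e^{G} μ / μ(e^{G})` through one-site
  Kantorovich–Rubinstein dual norms of `G`);
* **Comparison Theorem (2.8), measure level** (`abs_integral_sub_integral_le_of_defect`): for a Gibbs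
  measure `μ` of `γ`, any probability measure `ν` with functional defect `b ≥ 0`, row sums
  `Σ_{y ∈ nbr x} C x y ≤ c < 1` and any `d ≥ 0` with `b_x + Σ_{y ∈ nbr x} C x y d_y ≤ d_x`
  (`d = D b`, `D = Σ_m C^m`, in Föllmer's notation), every bounded measurable local `f` with
  coordinatewise `r`-Lipschitz bound `δ` satisfies `|∫ f dμ − ∫ f dν| ≤ Σ_{y ∈ Δ} d_y δ_y`.

TODO(general form): Föllmer's (2.8) is printed for countable index sets under (2.6)
`lim_n Σ_i C^n_{ik} = 0` and tempered measures (2.22); here row sums `≤ c < 1` ((2.7)).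

## References
* H. Föllmer, *Random fields and diffusion processes*, LNM 1362 (1988), Ch. I: (2.2), (2.3),
  Lemma (2.5), (2.7), Comparison Theorem (2.8), Remark (2.17) with (2.18)–(2.22).
* R. L. Dobrushin, Theory Probab. Appl. 15 (1970) 458–486, Thm. 3.
-/

noncomputable section

open MeasureTheory Finset Function

namespace Literature.Probability.LatticeModels

namespace DobrushinMetric

variable {V S : Type*} [MeasurableSpace S] {γ : Specification V S} {r : S → S → ℝ}
  {nbr : V → Finset V} {C : V → V → ℝ}

/-- **The expectation under any probability measure is a state** of the dusting data of a
specification under Dobrushin's condition (monotone normalisation `inf f ≤ ∫ f dν ≤ sup f`; no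
invariance) — Föllmer 1988, Ch. I, (2.3)/(2.8): the compared measure `ν` is arbitrary.
[cite: Follmer1988, Ch. I Comparison Theorem (2.8)] -/
theorem isState_integral [DecidableEq V] (hγ : IsSpecification γ) (hC : IsKRContraction γ r nbr C)
    {R : ℝ} (hr0 : ∀ a b, 0 ≤ r a b) (hrR : ∀ a b, r a b ≤ R) (hR : 0 ≤ R) (W : Set V)
    (ν : Measure (V → S)) [IsProbabilityMeasure ν] :
    (krDustingData hγ hC hr0 hrR hR W).IsState fun f => ∫ σ, f σ ∂ν := by
  refine ⟨fun {f Δ M} hf hM => ?_, fun {f Δ m} hf hm => ?_⟩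
  · obtain ⟨hfm, -, B, hB⟩ := hf
    calc ∫ σ, f σ ∂ν ≤ ∫ _σ, M ∂ν :=
          integral_mono (integrable_of_abs_le' hfm hB) (integrable_const M) hM
      _ = M := by simp
  · obtain ⟨hfm, -, B, hB⟩ := hf
    calc m = ∫ _σ, m ∂ν := by simp
      _ ≤ ∫ σ, f σ ∂ν := integral_mono (integrable_const m) (integrable_of_abs_le' hfm hB) hm

/-- **A functional defect bound is a defect vector** for the expectation under `ν`: if
`|∫ γ_x f dν − ∫ f dν| ≤ b_x δ_x(f)` for every usable `x` and every bounded measurable local `f`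
with coordinatewise `r`-Lipschitz bound `δ`, then `∫ · dν` has defect `b` in the sense of
`DustingData.HasDefect` (Föllmer 1988, Ch. I, (2.2)/(2.21) as used in the proof of Lemma (2.5):
`∫ |π_k(f|η) − ν_k(f|η)| ν(dη) ≤ b_k δ_k(f)`). [cite: Follmer1988, Ch. I Lemma (2.5)] -/
theorem hasDefect_integral [DecidableEq V] (hγ : IsSpecification γ)
    (hC : IsKRContraction γ r nbr C) {R : ℝ} (hr0 : ∀ a b, 0 ≤ r a b) (hrR : ∀ a b, r a b ≤ R)
    (hR : 0 ≤ R) (W : Set V) {ν : Measure (V → S)} {b : V → ℝ}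
    (hdef : ∀ x ∈ W, ∀ (f : (V → S) → ℝ) (Δ : Finset V) (δ : V → ℝ), Measurable f →
      DependsOn f (↑Δ : Set V) → (∃ M, ∀ σ, |f σ| ≤ M) → IsLipBound r f δ →
        |(∫ σ, siteAvg γ x f σ ∂ν) - ∫ σ, f σ ∂ν| ≤ b x * δ x) :
    (krDustingData hγ hC hr0 hrR hR W).HasDefect (fun f => ∫ σ, f σ ∂ν) b := by
  intro f Δ δ x hx hf hδ
  obtain ⟨hfm, hfdep, B, hB⟩ := hf
  exact hdef x hx f Δ δ hfm hfdep ⟨B, hB⟩ hδ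

/-- **Föllmer's Comparison Theorem (2.8) with defects, Vasserstein form, measure level.** Let `γ`
be a specification satisfying Dobrushin's condition in the Vasserstein form
(`IsKRContraction γ r nbr C`, weight `0 ≤ r ≤ R`, row sums `Σ_{y ∈ nbr x} C x y ≤ c < 1`), `μ` a
Gibbs measure of `γ`, and `ν` ANY probability measure with functional defect `b ≥ 0`
(`|∫ γ_x f dν − ∫ f dν| ≤ b_x δ_x(f)` for bounded measurable local `f` with coordinatewise
`r`-Lipschitz bound `δ`). Then for every `d ≥ 0` with `b_x + Σ_{y ∈ nbr x} C x y · d_y ≤ d_x`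
(Föllmer: `d = bD`, `D = Σ_m C^m`) and every bounded measurable `f` depending on `Δ` with
Lipschitz bound `δ`: `|∫ f dμ − ∫ f dν| ≤ Σ_{y ∈ Δ} d_y δ_y` — the abstract
`DustingData.abs_sub_le_sum_of_superSolution` with `E₁ = ∫ · dμ` (invariant by the DLR equations)
and `E₂ = ∫ · dν`. [cite: Follmer1988, Ch. I Comparison Theorem (2.8)] -/
theorem abs_integral_sub_integral_le_of_defect [DecidableEq V] (hγ : IsSpecification γ)
    (hC : IsKRContraction γ r nbr C) {R : ℝ} (hr0 : ∀ a b, 0 ≤ r a b) (hrR : ∀ a b, r a b ≤ R)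
    (hR : 0 ≤ R) {c : ℝ} (hc0 : 0 ≤ c) (hc1 : c < 1) (hrow : ∀ x, ∑ y ∈ nbr x, C x y ≤ c)
    {μ : Measure (V → S)} (hμ : IsGibbsMeasure γ μ) {ν : Measure (V → S)} [IsProbabilityMeasure ν]
    {b : V → ℝ} (hb : ∀ y, 0 ≤ b y)
    (hdef : ∀ (x : V) (f : (V → S) → ℝ) (Δ : Finset V) (δ : V → ℝ), Measurable f →
      DependsOn f (↑Δ : Set V) → (∃ M, ∀ σ, |f σ| ≤ M) → IsLipBound r f δ →
        |(∫ σ, siteAvg γ x f σ ∂ν) - ∫ σ, f σ ∂ν| ≤ b x * δ x)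
    {d : V → ℝ} (hd0 : ∀ y, 0 ≤ d y) (hd : ∀ x, b x + (∑ y ∈ nbr x, C x y * d y) ≤ d x)
    {f : (V → S) → ℝ} (hfm : Measurable f) {Δ : Finset V} (hfdep : DependsOn f (↑Δ : Set V))
    {M : ℝ} (hM : ∀ σ, |f σ| ≤ M) {δ : V → ℝ} (hδ : IsLipBound r f δ) :
    |(∫ σ, f σ ∂μ) - ∫ σ, f σ ∂ν| ≤ ∑ y ∈ Δ, d y * δ y := by
  have h₁ := isInvariantState_integral_of_isGibbsMeasure hγ hC hr0 hrR hR Set.univ hμ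
  have h₂ := isState_integral hγ hC hr0 hrR hR Set.univ ν
  have hb' : (krDustingData hγ hC hr0 hrR hR Set.univ).HasDefect (fun f => ∫ σ, f σ ∂ν) b :=
    hasDefect_integral hγ hC hr0 hrR hR Set.univ fun x _ => hdef x
  have hrowD : ∀ x, ∑ y ∈ (krDustingData hγ hC hr0 hrR hR Set.univ).nbr x,
      (krDustingData hγ hC hr0 hrR hR Set.univ).C x y ≤ c := fun x =>
    (sum_krDustingData_C hγ hC hr0 hrR hR Set.univ x).le.trans (hrow x)
  have hdD : ∀ x, b x + (krDustingData hγ hC hr0 hrR hR Set.univ).rowC d x ≤ d x := by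
    intro x
    have e : (krDustingData hγ hC hr0 hrR hR Set.univ).rowC d x = ∑ y ∈ nbr x, C x y * d y := by
      change ∑ y ∈ nbr x, (if y ∈ nbr x then C x y else 0) * d y = _
      exact Finset.sum_congr rfl fun y hy => by rw [if_pos hy]
    rw [e]
    exact hd x
  have hδ' := hδ.restrict hfdep
  have h := DustingData.abs_sub_le_sum_of_superSolution h₁ h₂ hb' hb hc0 hc1
    (fun x => Set.mem_univ x) hrowD hd0 hdD (f := f) (Δ := Δ) ⟨hfm, hfdep, M, hM⟩ hδ'
    (fun y hy => if_neg hy)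
  refine h.trans (Finset.sum_le_sum fun y hy => ?_)
  rw [if_pos hy]

end DobrushinMetric

end Literature.Probability.LatticeModels

end
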